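import Summits.Ventures.PercRepro.ProfilePointedCircuitClassesFiveParallelPair

/-!
# PercRepro — `InOutBottomFive` REDUCES TO COLOOP-FREE SIMPLE MATROIDS (p5, gen 50; `proofs/P5-GM1.md` §75(a))

Gen 42's `inOutBottomFive_of_coloopFree_twinFree` (§63(b)) reduces the per-point in–out inequality at the bottom of
nullity 5 to coloop-free matroids at twin-free non-loop points; gen 50's `inCount_five_le_outCount_six_of_parallel_pair`
settles every point avoided by a parallel pair.  Together: `InOutBottomFive` holds as soon as it holds on coloop-free
SIMPLE matroids (no two distinct non-loops parallel) at non-loop points.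
-/

open scoped Matroid

namespace PercRepro.Cogirth

open Finset ThmH Skew Shadow Profile

variable {α : Type} [DecidableEq α] {N : Matroid α} [N.Finite]

section FiveSimpleReduce

/-- **`InOutBottomFive` HOLDS AS SOON AS IT HOLDS ON COLOOP-FREE SIMPLE MATROIDS** (at non-loop points): the
reduction of §63 (`inOutBottomFive_of_coloopFree_twinFree`) leaves coloop-free matroids at twin-free points, and a
parallel pair elsewhere is `inCount_five_le_outCount_six_of_parallel_pair`; what remains is a simple matroid (no two
distinct non-loops parallel). -/
theorem inOutBottomFive_of_coloopFree_simple
    (h : ∀ (N : Matroid α) [N.Finite] (e : α), e ∈ gr N → (gr N).card = rk N (gr N) + 5 → 7 ≤ rk N (gr N) →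
      (∀ x ∈ gr N, rk N ((gr N).erase x) = rk N (gr N)) → rk N {e} = 1 →
      (∀ u ∈ gr N, ∀ v ∈ gr N, u ≠ v → rk N {u} = 1 → rk N {v} = 1 → v ∉ clF N {u}) →
      inCount N 5 e ≤ outCount N 6 e) :
    InOutBottomFive α := by
  apply inOutBottomFive_of_coloopFree_twinFree
  intro N _ e he hn hR hcf hre htf
  by_cases hsimple : ∀ u ∈ gr N, ∀ v ∈ gr N, u ≠ v → rk N {u} = 1 → rk N {v} = 1 → v ∉ clF N {u}
  · exact h N e he hn hR hcf hre hsimple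
  · push Not at hsimple
    obtain ⟨u, hu, v, hv, huv, hru, hrv, hcl⟩ := hsimple
    -- the pair avoids `e`: `e` is twin-free
    have heu : e ≠ u := by
      rintro rfl
      exact htf v hv (Ne.symm huv) hrv hcl
    have hev : e ≠ v := by
      rintro rfl
      exact htf u hu huv hru (mem_clF_singleton_of_parallel hu hv hru hrv hcl)
    exact inCount_five_le_outCount_six_of_parallel_pair hn hR he hu hv huv heu hev hru hrv hcl

end FiveSimpleReduce

end PercRepro.Cogirth
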